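import Summits.QuantumFields.YangMills.Theorems.BalabanUVNodesN21ClosenessAtRecord
import Summits.QuantumFields.YangMills.Theorems.BalabanUVNodesN16AtKeyedHome
import Summits.QuantumFields.YangMills.Theorems.BalabanUVNodesN21ThresholdSyncAtRecord

/-!
# YM-DAG node N21 (= NE7c) AT A KEYED RATE HOME, STAGE-FREE: the in-edge N16 → N21 at the home's NE3 bundles `ne3OfRecord₁₁ F (o K)` under N16's
# record decl `N16At` (supplied BY NAME at any keyed home by `N16AtKeyedHome.covRoot_of_attains`), road I's (F∞)-rates `ρ_j ≤ c·θ^j` FOR EVERY LEVEL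
# (both runs) at the family's base `θ⁶ = (F.L)⁻¹` from displayed [dict] clauses, and NE7c's `ShellWeightBound` AT EXPLICIT CARRIERS with a geometric
# weight from these + node U2's threshold widths

Track A of `YM-PLAN.md` (cell `pub-ymgap`, HUMAN RULING D-0062), node **N21**; R134 fan-out seat `pub-ymgap-dag-n21-d` (strategy s2 = BY-NAME KNIT at the
record), generation 2, module 5 — the successor module the seat's HANDOFF bound to the landing of the rate home's layer B (`BalabanUVNodesRateCarriersOfRecord11`,
dag-n22-e, p457330: `ne3OfRecord₁₁`) and of N16's face at it (dag-n16-e: `N16AtRRec11.covRoot_rRec₁₁`, `N16AtKeyedHome.covRoot_of_attains`).  WHY STAGE-FREE: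
the Stage-11 key is EMPTY (`Node00.not_provisos₁₁`, `Node00/Record12.lean` §4) — every face keyed by `IsDatumOfRecord₁₁C` is located-vacuous —, and N16's side of
ANY keyed home (Stage 12, …) is delivered at the STAGE-FREE literal `ne3OfRecord₁₁ F o`, `o : Node00.NE3Objects₁₁ N` (`N16AtKeyedHome`).  So everything below
is stated over a family `o : ℕ → NE3Objects₁₁ N` of NE3 layers (one per run length `K`) of ONE four-torus family `F` under `N16At (ne3OfRecord₁₁ F (o K))`, and
§5 instantiates it at any keyed home BY NAME.  THEOREMS ONLY: 0 `def`, 0 `sorry`, standard axioms; COUNT-NEUTRAL; `--supports` the K3 item `SpineGivenEndpointR11`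
(stmt-QuantumFields-19676).  Restate-immune (no Theses import).

WHAT IS PROVED ([folklore] bookkeeping + real arithmetic; every estimate enters as ONE application of a landed tree theorem BY NAME).
* §1 `exists_familyBase` (SOME `θ ∈ (0,1)` with `θ⁶ = (F.L)⁻¹`: `NE7EtaRatesD4.exists_sixth_root`, [Balaban1987RG1] p. 251 «L > 11»);
  `signs_of_inEndRegime_ne3OfRecord₁₁` (n16-e's DISPLAYED proviso discharges the sign letters `1 ≤ o.Nper`, `0 ≤ o.b`, `0 ≤ o.g`, `0 ≤ o.C`).
* §2 THE N16 → N21 EDGE AT ONE NE3 BUNDLE OF THE HOME — dag-n21-a's files 3 ∕ 6 ∕ 7 (`N21ClosenessJunction.relWidth_of_n16`,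
  `N21FineTestJunction.relWidth_fineTest_of_n16`, `N21SlotSupJunction.abs_slotA_sub_slotB_le_of_n16`) with `hcov := h16 : N16At (ne3OfRecord₁₁ F o)` at the
  object's letters and the block factor `F.L` (file 9's clause `2 ≤ L` is the FAMILY's, DISCHARGED): `relWidth_ne3Layer` (run A's slots in threshold units
  `≤ (C_Q∕ε′)·θ^k`), `relWidth_fineTest_ne3Layer` (run B's OWN fine test `≤ ((C_Q + K)∕ε′)·θ^k`), `abs_slotA_sub_slotB_ne3Layer` (the (2.17) cube `sup`).
* §3 ROAD I's (F∞)-RATES FOR EVERY LEVEL — `rate_of_slotWidths_ne3Layers` (run A) ∕ `rate_of_fineTestWidths_ne3Layers` (run B): under `N16At` at every layer,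
  END side letters UNIFORM in the run length (ONE energy letter `γ`, ONE cube root `l₁`, a bound `Λ̄` of the `Λ₂'`-letters, one flux letter `cg`), and the
  displayed [dict] clause «the level-`j` width `ρ j` of a term ledger is at most EVERY uniform bound of the relative two-run widths of the minimisers' slot
  variables at levels `j`, `j+1` over the layers' domains» (`j ≥ 1`): `∃ c ≥ 0, ∀ j, ρ j ≤ c·θ^j` — road I's binder `hrate` of `n21_knit_levels` LITERALLY;
  the fit threshold (`exists_fit_threshold`) and the early levels ride in the constant (`exists_geometric_majorant`).
* §4 `shellWeightBound_geometric_of_ne3Layers` — **NE7c's `ShellWeightBound` AT EXPLICIT CARRIERS `(l₀, T, A, B, shA, shB)` WITH THE GEOMETRIC WEIGHT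
  `C·(θ ∨ ϑ₂)^K`, SOME `C ≥ 0`**, from: the two runs' LEVEL LEDGERS ([dict] + (M1)), LIVE WINDOWS (N20), `D ≤ D̄` (N12), `N16At` at the layers + END letters +
  the two [dict] clauses with THRESHOLD widths `τ ≤ c₂ϑ₂^j` (node U2: the relative band between the two runs' coupling-dependent thresholds of record,
  `N21ThresholdSyncAtRecord.abs_epsOfRecord_runs_sub_le_of_u2Output`, p455507) — §3 twice + `n21_knit_levels_of_twoWidths`; `s_N21_of_levels_twoWidths` — the
  K5 stub `S_N21 SRec` for ANY spine-carrier predicate whose pinned bundles carry that package at two width families (generic; one application at any `SRec₁₂`).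
* §5 AT ANY KEYED HOME BY NAME — `shellWeightBound_geometric_of_attains`: §4 with the in-edge supplied as the K4 stub `S_N16 RRec` for a home `RRec` that
  ATTAINS the literals of a key-indexed NE3 reading `ne3At` (n16-e's `covRoot_of_attains`; Stage-11 certificate `attains_rRec₁₁` — vacuous key).

HONEST FRAMING (binding).  `N16At` at the layers ∕ `S_N16 RRec` are HYPOTHESES (NE3 NOT PROVED; content enters only through a definer's PIN of the NE3 reading);
readings are RESIDUAL (no reading of Bałaban's dressed two-run class expansion exists in the tree — NODE O); the level ledgers ((M1) NOT PRINTED + [dict]), live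
windows, `D ≤ D̄`, END side letters, threshold widths and the [dict] clauses are HYPOTHESES, displayed; nothing of Bałaban's is asserted or instantiated; NE7c
is NOT PRINTED and NOT PROVED; **N21 is NOT discharged** (0∕1 at every record); typed 28∕28, discharged count untouched; one finite four-torus programme at
fixed `ε` — NOT ℝ⁴, NOT infinite volume, NOT OS, NOT a mass gap, NOT Clay.  No decl below carries a cite tag.
-/

set_option autoImplicit false

noncomputable section

open scoped BigOperators Matrix Matrix.Norms.L2Operator

namespace Summit.QuantumFields.YangMills.Theorems.N21AtKeyedRateHome

open Literature.MathematicalPhysics.QuantumFieldTheory.Balaban1983to89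
open Literature.MathematicalPhysics.QuantumFieldTheory.Balaban1983to89.T4Continuum (T4Family ULoop)
open B7Prop1Explicit B7Prop2Explicit
open T4AveragingDeficitWall (Plane)
open T4IndicatorShell (ShellWeightBound)
open T4ShellMeasureLevels (LevelLedger LiveWindow)
open Summit.QuantumFields.BalabanUV.T4Continuum
open MinimalActionSandwich (IsMinimiser)
open MinimalActionRate (Regular sfClass)
open MinimalActionRefine (RegularSup)
open AveragingDeficitDualResidual (dualC1 dualC2)
open AveragingDeficitDerivWallProof (wallConst)
open NE7EtaRatesD4 (exists_sixth_root exists_fit_threshold exists_geometric_majorant)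
open HistoryFlow (two_le_L)
open YMDAG.UVSplit (Datum RateCarriers RateRecordPred SpineCarriers SpineRecordPred S_N21 S_N16 N16At ne3OfRecord₁₁)
open Summit.QuantumFields.YangMills.BalabanUVNodes.N16Regime (InEndRegime constOfRecord_nonneg)
open Summit.QuantumFields.YangMills.BalabanUVNodes.N16AtRRec11 (n16At_ne3OfRecord₁₁_iff inEndRegime_ne3OfRecord₁₁_iff)
open Summit.QuantumFields.YangMills.BalabanUVNodes.N16AtKeyedHome (covRoot_of_attains)
open N21ClosenessJunction (relWidth_of_n16)
open N21FineTestJunction (relWidth_fineTest_of_n16)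
open N21SlotSupJunction (abs_slotA_sub_slotB_le_of_n16)
open N21ThresholdSyncAtRecord (n21_knit_levels_of_twoWidths)
open Node00 (NE3Objects₁₁ ne3LOfRecord₁₁_eq)

variable {N : ℕ} [NeZero N]

/-! ## §1 The family's rate base; the proviso discharges the sign letters -/

/-- **THE FAMILY's RATE BASE**: some `θ ∈ (0, 1)` with `θ⁶ = (F.L)⁻¹` (`θ_F = L^{−1∕6}`) — the base `ϑ` of road I's rate binder. [folklore] -/
theorem exists_familyBase (F : T4Family) : ∃ θ : ℝ, 0 < θ ∧ θ < 1 ∧ θ ^ 6 = ((F.L : ℝ))⁻¹ :=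
  exists_sixth_root (two_le_L F)

/-- **THE DISPLAYED PROVISO DISCHARGES THE SIGN LETTERS**: n16-e's `InEndRegime` at the home's NE3 bundle `ne3OfRecord₁₁ F o` gives the sign side-letters the N21
faces below take — `1 ≤ o.Nper`, `0 ≤ o.b`, `0 ≤ o.g`, `0 ≤ o.C` (`constOfRecord ≥ 0` on the side conditions). [folklore] -/
theorem signs_of_inEndRegime_ne3OfRecord₁₁ (F : T4Family) (o : NE3Objects₁₁ N) (hreg : InEndRegime (ne3OfRecord₁₁ F o)) :
    1 ≤ o.Nper ∧ 0 ≤ o.b ∧ 0 ≤ o.g ∧ 0 ≤ o.C := by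
  obtain ⟨hN, hg, -, -, -, -, hb, -, hC⟩ := (inEndRegime_ne3OfRecord₁₁_iff F o).1 hreg
  exact ⟨hN, hb, hg.le, (constOfRecord_nonneg (N := N) (two_le_L F) hN hg).trans hC⟩

/-! ## §2 The N16 → N21 edge at ONE NE3 bundle `ne3OfRecord₁₁ F o` of the home (files 3 ∕ 6 ∕ 7; block factor `F.L`, `2 ≤ L` discharged) -/

section Edge

variable {F : T4Family} {o : NE3Objects₁₁ N} {θ γ l₁ : ℝ} {k : ℕ} {V UA UB : B7Prop1Explicit.Site 4 → Fin 4 → (Matrix (Fin N) (Fin N) ℂ)ˣ}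
  (h16 : N16At (ne3OfRecord₁₁ F o))
  (hN : 1 ≤ o.Nper) (hθ : 0 < θ) (hθ6 : θ ^ 6 = ((F.L : ℝ))⁻¹) (hb : 0 ≤ o.b)
  (hbs : 512 * (4 + 1) * (4 + 4) * (F.L : ℝ) ^ 2 * o.b ≤ 1) (hg : 0 ≤ o.g) (hC : 0 ≤ o.C) (hΛ₂' : 0 < o.Λ₂') (hγ : 0 < γ)
  (hγ3 : o.C * (wallConst 4 F.L * (o.Nper : ℝ) ^ 2 * (Real.sqrt o.g * dualC2 4 F.L + 2 * o.b ^ 2 * dualC1 4 F.L)) ≤ γ ^ 3)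
  (hl₁ : 0 < l₁) (hΛl₁ : o.Λ₁ ≤ l₁ ^ 3) (hk : 1 ≤ k) (hfit : γ * (θ ^ k) ^ 2 ≤ l₁ * o.Nper) (hV : V ∈ o.dom)
  (hA : IsMinimiser 4 (sfClass 4 F.L o.Nper o.ε) F.L o.Nper k V UA)
  (hB : IsMinimiser 4 (sfClass 4 F.L o.Nper o.ε) F.L o.Nper (k + 1) V UB)
  (hregB : Regular 4 F.L o.Nper o.b o.g (k + 1) UB)

include h16 hN hθ hθ6 hb hbs hg hC hΛ₂' hγ hγ3 hl₁ hΛl₁ hk hfit hV hA hB hregB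

/-- **ROAD I's RATE BINDER AT THE BUNDLE, RUN A's SLOTS, ONE LEVEL.**  HYPOTHESES: N16's record decl `h16 : N16At (ne3OfRecord₁₁ F o)` (at a keyed home:
`covRoot_of_attains`); the END's side letters at `o`'s letters and the block factor `F.L` (base `θ⁶ = (F.L)⁻¹`, regularity numeral, energy letter `γ`, cube root
`l₁`, fit); a level `k ≥ 1`; `V ∈ o.dom`; the runs' minimisers at levels `k`, `k+1`, `U_B` regular; a threshold `t ≥ ε′·(F.L)^{−2k}`.  CONCLUSION:
`|‖U_A(∂p) − 1‖ − ‖W(∂p) − 1‖|∕t ≤ (C_Q∕ε′)·θ^k`, `W = rescale L (bavg L U_B)`, `C_Q = 8l₁√(2γΛ₂′) + 1536l₁⁴γ²e^{8l₁²γ}` — file 3's `relWidth_of_n16`. [folklore] -/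
theorem relWidth_ne3Layer {ε' t : ℝ} (hε' : 0 < ε') (ht : ε' * ((F.L : ℝ)⁻¹) ^ (2 * k) ≤ t) (z : B7Prop1Explicit.Site 4) (μ ν : Fin 4) :
    |‖((hol UA z (plaqWord μ ν) : (Matrix (Fin N) (Fin N) ℂ)ˣ) : Matrix (Fin N) (Fin N) ℂ) - 1‖
        - ‖((hol (rescale F.L (bavg F.L UB)) z (plaqWord μ ν) : (Matrix (Fin N) (Fin N) ℂ)ˣ) : Matrix (Fin N) (Fin N) ℂ) - 1‖| / t
      ≤ (8 * l₁ * Real.sqrt (2 * γ * o.Λ₂') + 1536 * l₁ ^ 4 * γ ^ 2 * Real.exp (8 * l₁ ^ 2 * γ)) / ε' * θ ^ k := by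
  haveI := N21ClosenessAtRecord.nonempty_fin (N := N)
  have hcov := (n16At_ne3OfRecord₁₁_iff F o).1 h16
  rw [ne3LOfRecord₁₁_eq] at hcov
  exact relWidth_of_n16 (two_le_L F) hN hθ hθ6 hb hbs hg hC hΛ₂' hcov hγ hγ3 hl₁ hΛl₁ hk hfit hV hA hB hregB hε' ht z μ ν

/-- **ROAD I's RATE BINDER AT THE BUNDLE, RUN B READ BY ITS OWN FINE TEST, ONE LEVEL.**  Under the hypotheses of `relWidth_ne3Layer` PLUS `hsup : RegularSup 4 F.L
o.Nper o.b cg (k+1) U_B` (`cg ≥ 0`; N07's species): for every coarse plaquette `(z; π)`, fine stencil plaquette `L·z + boxVec L r₀ + i₀e_μ + j₀e_ν` and threshold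
`t ≥ ε′·(F.L)^{−2k}`: `|‖U_A(∂p′) − 1‖ − L²‖U_B(∂p₀) − 1‖|∕t ≤ ((C_Q + K)∕ε′)·θ^k`, `K = 48cg + (480 + 14464·25·64)b²` — file 6's `relWidth_fineTest_of_n16`. [folklore] -/
theorem relWidth_fineTest_ne3Layer {cg : ℝ} (hcg : 0 ≤ cg) (hsup : RegularSup 4 F.L o.Nper o.b cg (k + 1) UB)
    {ε' t : ℝ} (hε' : 0 < ε') (ht : ε' * ((F.L : ℝ)⁻¹) ^ (2 * k) ≤ t)
    (z : B7Prop1Explicit.Site 4) (π : Plane 4) (r₀ : Fin 4 → Fin F.L) {i₀ j₀ : ℕ} (hi₀ : i₀ < F.L) (hj₀ : j₀ < F.L) :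
    |‖((hol UA z (plaqWord π.1.1 π.1.2) : (Matrix (Fin N) (Fin N) ℂ)ˣ) : Matrix (Fin N) (Fin N) ℂ) - 1‖
        - (F.L : ℝ) ^ 2 * ‖((hol UB ((F.L : ℤ) • z + boxVec F.L r₀ + (i₀ : ℤ) • e π.1.1 + (j₀ : ℤ) • e π.1.2)
            (plaqWord π.1.1 π.1.2) : (Matrix (Fin N) (Fin N) ℂ)ˣ) : Matrix (Fin N) (Fin N) ℂ) - 1‖| / t
      ≤ ((8 * l₁ * Real.sqrt (2 * γ * o.Λ₂') + 1536 * l₁ ^ 4 * γ ^ 2 * Real.exp (8 * l₁ ^ 2 * γ))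
          + (4 * (2 * 4 + 4) * cg + (4 * (4 + 2) * (3 * 4 + 8) + 14464 * (4 + 1) ^ 2 * (4 + 4) ^ 2) * o.b ^ 2)) / ε'
        * θ ^ k := by
  haveI := N21ClosenessAtRecord.nonempty_fin (N := N)
  have hcov := (n16At_ne3OfRecord₁₁_iff F o).1 h16
  rw [ne3LOfRecord₁₁_eq] at hcov
  exact relWidth_fineTest_of_n16 (two_le_L F) hN hθ hθ6 hb hbs hg hC hΛ₂' hcov hγ hγ3 hl₁ hΛl₁ hk hfit hV hA hB hregB hcg hsup
    hε' ht z π r₀ hi₀ hj₀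

/-- **THE EDGE AT THE BUNDLE, SLOT LEVEL (the (2.17) cube `sup`).**  Under the hypotheses of `relWidth_ne3Layer` PLUS `hsup`, for every BLOCK-ALIGNED pair of
nonempty finite plaquette sets `I`, `J`: `|max_I ‖U_A(∂p) − 1‖ − max_J L²‖U_B(∂p) − 1‖| ≤ C_Qθ^{13k} + E_{k+1}` — file 7's `abs_slotA_sub_slotB_le_of_n16`. [folklore] -/
theorem abs_slotA_sub_slotB_ne3Layer {cg : ℝ} (hsup : RegularSup 4 F.L o.Nper o.b cg (k + 1) UB) (π : Plane 4)
    {I J : Finset (B7Prop1Explicit.Site 4)} (hI : I.Nonempty) (hJ : J.Nonempty)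
    (hIJ : ∀ x ∈ I, (F.L : ℤ) • x ∈ J)
    (hJI : ∀ w ∈ J, ∀ (x : B7Prop1Explicit.Site 4) (r : Fin 4 → Fin F.L), w = (F.L : ℤ) • x + boxVec F.L r → x ∈ I) :
    |I.sup' hI (fun x => ‖((hol UA x (plaqWord π.1.1 π.1.2) : (Matrix (Fin N) (Fin N) ℂ)ˣ) : Matrix (Fin N) (Fin N) ℂ) - 1‖)
        - J.sup' hJ (fun w => (F.L : ℝ) ^ 2 *
            ‖((hol UB w (plaqWord π.1.1 π.1.2) : (Matrix (Fin N) (Fin N) ℂ)ˣ) : Matrix (Fin N) (Fin N) ℂ) - 1‖)|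
      ≤ (8 * l₁ * Real.sqrt (2 * γ * o.Λ₂') + 1536 * l₁ ^ 4 * γ ^ 2 * Real.exp (8 * l₁ ^ 2 * γ)) * θ ^ (13 * k)
        + ((F.L : ℝ) ^ 2 * (((2 * (4 * F.L) + 4 * F.L : ℕ) : ℝ)
          * (cg / ((F.L : ℝ) ^ (k + 1)) ^ 3 * Real.exp (2 * (o.b / ((F.L : ℝ) ^ (k + 1)) ^ 2))
            + 2 * (((3 * (4 * F.L) + 8 * F.L : ℕ) : ℝ) * (o.b / ((F.L : ℝ) ^ (k + 1)) ^ 2))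
              * (o.b / ((F.L : ℝ) ^ (k + 1)) ^ 2)))
        + 226 * (8 * ((4 : ℕ) + 1 : ℝ) * ((4 : ℕ) + 4 : ℝ) * (F.L : ℝ) ^ 2 * (o.b / ((F.L : ℝ) ^ (k + 1)) ^ 2)) ^ 2) := by
  haveI := N21ClosenessAtRecord.nonempty_fin (N := N)
  have hcov := (n16At_ne3OfRecord₁₁_iff F o).1 h16
  rw [ne3LOfRecord₁₁_eq] at hcov
  exact abs_slotA_sub_slotB_le_of_n16 (two_le_L F) hN hθ hθ6 hb hbs hg hC hΛ₂' hcov hγ hγ3 hl₁ hΛl₁ hk hfit hV hA hB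
    hregB hsup π hI hJ hIJ hJI

end Edge

/-! ## §3 Road I's (F∞)-rates FOR EVERY LEVEL: [dict] clause + run-length-uniform END letters ⇒ `∃ c ≥ 0, ρ j ≤ c·θ^j` (both runs) -/

/-- The N16 constant `C_Q(Λ₂′) = 8l₁√(2γΛ₂′) + 1536l₁⁴γ²e^{8l₁²γ}` is monotone in `Λ₂′` (`γ, l₁ ≥ 0`). [folklore] -/
theorem cQ_le_of_le {γ l₁ Λ Λ' : ℝ} (hγ : 0 ≤ γ) (hl₁ : 0 ≤ l₁) (hΛ : Λ ≤ Λ') :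
    8 * l₁ * Real.sqrt (2 * γ * Λ) + 1536 * l₁ ^ 4 * γ ^ 2 * Real.exp (8 * l₁ ^ 2 * γ) ≤
      8 * l₁ * Real.sqrt (2 * γ * Λ') + 1536 * l₁ ^ 4 * γ ^ 2 * Real.exp (8 * l₁ ^ 2 * γ) := by
  nlinarith [mul_le_mul_of_nonneg_left (Real.sqrt_le_sqrt (mul_le_mul_of_nonneg_left hΛ (by positivity : (0:ℝ) ≤ 2 * γ))) (by positivity : (0 : ℝ) ≤ 8 * l₁)]

section Rate

variable {F : T4Family} {o : ℕ → NE3Objects₁₁ N} (h16 : ∀ K, N16At (ne3OfRecord₁₁ F (o K)))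
  {θ γ l₁ Λbar ε' : ℝ} (hθ : 0 < θ) (hθ1 : θ < 1) (hθ6 : θ ^ 6 = ((F.L : ℝ))⁻¹)
  (hN : ∀ K, 1 ≤ (o K).Nper) (hb : ∀ K, 0 ≤ (o K).b) (hbs : ∀ K, 512 * (4 + 1) * (4 + 4) * (F.L : ℝ) ^ 2 * (o K).b ≤ 1)
  (hg : ∀ K, 0 ≤ (o K).g) (hC : ∀ K, 0 ≤ (o K).C) (hΛ₂' : ∀ K, 0 < (o K).Λ₂') (hΛbar : ∀ K, (o K).Λ₂' ≤ Λbar) (hγ : 0 < γ)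
  (hγ3 : ∀ K, (o K).C * (wallConst 4 F.L * ((o K).Nper : ℝ) ^ 2 *
    (Real.sqrt (o K).g * dualC2 4 F.L + 2 * (o K).b ^ 2 * dualC1 4 F.L)) ≤ γ ^ 3)
  (hl₁ : 0 < l₁) (hΛl₁ : ∀ K, (o K).Λ₁ ≤ l₁ ^ 3) (hε' : 0 < ε')

include h16 hθ hθ1 hθ6 hN hb hbs hg hC hΛ₂' hΛbar hγ hγ3 hl₁ hΛl₁ hε'

/-- **ROAD I's (F∞)-RATE FOR EVERY LEVEL, RUN A's SLOTS.**  HYPOTHESES: `h16 : ∀ K, N16At (ne3OfRecord₁₁ F (o K))` at the layers `o K` (one per run length; at a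
keyed home: `covRoot_of_attains`, §5); a family base `θ ∈ (0,1)`, `θ⁶ = (F.L)⁻¹`; END side letters UNIFORM IN `K` (signs, regularity numeral, `0 < Λ₂′_K ≤ Λ̄`, ONE
energy letter `γ`, ONE cube root `l₁`); a threshold unit `ε′ > 0`; a level-width sequence `ρ` of a term ledger; the [dict] clause `hdict`: for every `j ≥ 1`, `ρ j`
is at most EVERY real `x` bounding `|‖U_A(∂p) − 1‖ − ‖W_B(∂p) − 1‖|∕t` uniformly over run lengths `K`, data `V ∈ (o K).dom`, minimiser pairs at levels `j`, `j+1`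
(`U_B` regular), plaquettes, thresholds `t ≥ ε′·(F.L)^{−2j}`.  CONCLUSION: `∃ c ≥ 0, ∀ j, ρ j ≤ c·θ^j` — road I's `hrateA` (`relWidth_ne3Layer` past the fit
threshold `exists_fit_threshold`, `cQ_le_of_le`, early levels in the constant by `exists_geometric_majorant`).  CONDITIONAL on `h16` + [dict]. [folklore] -/
theorem rate_of_slotWidths_ne3Layers {ρ : ℕ → ℝ}
    (hdict : ∀ j, 1 ≤ j → ∀ x : ℝ,
      (∀ (K : ℕ) (V UA UB : B7Prop1Explicit.Site 4 → Fin 4 → (Matrix (Fin N) (Fin N) ℂ)ˣ) (z : B7Prop1Explicit.Site 4) (μ ν : Fin 4) (t : ℝ),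
        V ∈ (o K).dom → IsMinimiser 4 (sfClass 4 F.L (o K).Nper (o K).ε) F.L (o K).Nper j V UA →
        IsMinimiser 4 (sfClass 4 F.L (o K).Nper (o K).ε) F.L (o K).Nper (j + 1) V UB → Regular 4 F.L (o K).Nper (o K).b (o K).g (j + 1) UB →
        ε' * ((F.L : ℝ)⁻¹) ^ (2 * j) ≤ t →
        |‖((hol UA z (plaqWord μ ν) : (Matrix (Fin N) (Fin N) ℂ)ˣ) : Matrix (Fin N) (Fin N) ℂ) - 1‖
            - ‖((hol (rescale F.L (bavg F.L UB)) z (plaqWord μ ν) : (Matrix (Fin N) (Fin N) ℂ)ˣ) : Matrix (Fin N) (Fin N) ℂ) - 1‖| / t ≤ x) →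
      ρ j ≤ x) :
    ∃ c : ℝ, 0 ≤ c ∧ ∀ j, ρ j ≤ c * θ ^ j := by
  obtain ⟨k₁, hk₁⟩ := exists_fit_threshold hθ.le hθ1 γ hl₁
  have hrate : ∀ j, max 1 k₁ ≤ j →
      ρ j ≤ (8 * l₁ * Real.sqrt (2 * γ * Λbar) + 1536 * l₁ ^ 4 * γ ^ 2 * Real.exp (8 * l₁ ^ 2 * γ)) / ε' * θ ^ j := by
    intro j hj
    have hj1 : 1 ≤ j := le_trans (le_max_left _ _) hj
    have hjk : k₁ ≤ j := le_trans (le_max_right _ _) hj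
    refine hdict j hj1 _ fun K V UA UB z μ ν t hV hA hB hregB ht => ?_
    have hfit : γ * (θ ^ j) ^ 2 ≤ l₁ * (o K).Nper := by
      have h1 : (1 : ℝ) ≤ (o K).Nper := by exact_mod_cast hN K
      nlinarith [hk₁ j hjk]
    exact (relWidth_ne3Layer (h16 K) (hN K) hθ hθ6 (hb K) (hbs K) (hg K) (hC K) (hΛ₂' K) hγ (hγ3 K) hl₁ (hΛl₁ K) hj1 hfit hV hA hB hregB
      hε' ht z μ ν).trans
      (mul_le_mul_of_nonneg_right (div_le_div_of_nonneg_right (cQ_le_of_le hγ.le hl₁.le (hΛbar K)) hε'.le) (pow_nonneg hθ.le j))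
  exact exists_geometric_majorant hθ hrate

/-- **ROAD I's (F∞)-RATE FOR EVERY LEVEL, RUN B's OWN SLOTS.**  As `rate_of_slotWidths_ne3Layers`, with ONE flux letter `cg ≥ 0` and the [dict] clause against
run B's OWN fine test: for `j ≥ 1`, `ρ j` is at most every `x` bounding `|‖U_A(∂p′) − 1‖ − L²‖U_B(∂p₀) − 1‖|∕t` uniformly over run lengths, data, minimiser pairs
(`U_B` regular AND `RegularSup … cg (j+1) U_B`), coarse plaquettes `(z; π)`, stencil plaquettes (`i₀, j₀ < L`), thresholds `t ≥ ε′·(F.L)^{−2j}`.  CONCLUSION: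
`∃ c ≥ 0, ∀ j, ρ j ≤ c·θ^j` — road I's `hrateB` (`relWidth_fineTest_ne3Layer`; the `b²`-term bounded through the regularity numeral). [folklore] -/
theorem rate_of_fineTestWidths_ne3Layers {cg : ℝ} (hcg : 0 ≤ cg) {ρ : ℕ → ℝ}
    (hdict : ∀ j, 1 ≤ j → ∀ x : ℝ,
      (∀ (K : ℕ) (V UA UB : B7Prop1Explicit.Site 4 → Fin 4 → (Matrix (Fin N) (Fin N) ℂ)ˣ) (z : B7Prop1Explicit.Site 4) (π : Plane 4)
        (r₀ : Fin 4 → Fin F.L) (i₀ j₀ : ℕ) (t : ℝ),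
        V ∈ (o K).dom → IsMinimiser 4 (sfClass 4 F.L (o K).Nper (o K).ε) F.L (o K).Nper j V UA →
        IsMinimiser 4 (sfClass 4 F.L (o K).Nper (o K).ε) F.L (o K).Nper (j + 1) V UB → Regular 4 F.L (o K).Nper (o K).b (o K).g (j + 1) UB →
        RegularSup 4 F.L (o K).Nper (o K).b cg (j + 1) UB → i₀ < F.L → j₀ < F.L → ε' * ((F.L : ℝ)⁻¹) ^ (2 * j) ≤ t →
        |‖((hol UA z (plaqWord π.1.1 π.1.2) : (Matrix (Fin N) (Fin N) ℂ)ˣ) : Matrix (Fin N) (Fin N) ℂ) - 1‖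
            - (F.L : ℝ) ^ 2 * ‖((hol UB ((F.L : ℤ) • z + boxVec F.L r₀ + (i₀ : ℤ) • e π.1.1 + (j₀ : ℤ) • e π.1.2)
                (plaqWord π.1.1 π.1.2) : (Matrix (Fin N) (Fin N) ℂ)ˣ) : Matrix (Fin N) (Fin N) ℂ) - 1‖| / t ≤ x) →
      ρ j ≤ x) :
    ∃ c : ℝ, 0 ≤ c ∧ ∀ j, ρ j ≤ c * θ ^ j := by
  obtain ⟨k₁, hk₁⟩ := exists_fit_threshold hθ.le hθ1 γ hl₁
  have hL2 : (2 : ℝ) ≤ F.L := by exact_mod_cast two_le_L F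
  have hrate : ∀ j, max 1 k₁ ≤ j →
      ρ j ≤ ((8 * l₁ * Real.sqrt (2 * γ * Λbar) + 1536 * l₁ ^ 4 * γ ^ 2 * Real.exp (8 * l₁ ^ 2 * γ))
          + (4 * (2 * 4 + 4) * cg + (4 * (4 + 2) * (3 * 4 + 8) + 14464 * (4 + 1) ^ 2 * (4 + 4) ^ 2) * 1)) / ε' * θ ^ j := by
    intro j hj
    have hj1 : 1 ≤ j := le_trans (le_max_left _ _) hj
    have hjk : k₁ ≤ j := le_trans (le_max_right _ _) hj
    refine hdict j hj1 _ fun K V UA UB z π r₀ i₀ j₀ t hV hA hB hregB hsup hi₀ hj₀ ht => ?_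
    have hfit : γ * (θ ^ j) ^ 2 ≤ l₁ * (o K).Nper := by
      have h1 : (1 : ℝ) ≤ (o K).Nper := by exact_mod_cast hN K
      nlinarith [hk₁ j hjk]
    have hb1 : (o K).b ^ 2 ≤ 1 := by
      have hL4 : (4 : ℝ) ≤ (F.L : ℝ) ^ 2 := by nlinarith [hL2]
      have hbL : 0 ≤ (o K).b * ((F.L : ℝ) ^ 2 - 4) := mul_nonneg (hb K) (by linarith)
      have hb_le : (o K).b ≤ 1 := by nlinarith [hbs K, hb K, hbL]
      exact pow_le_one₀ (hb K) hb_le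
    have hK : (4 * (2 * 4 + 4) * cg + (4 * (4 + 2) * (3 * 4 + 8) + 14464 * (4 + 1) ^ 2 * (4 + 4) ^ 2) * (o K).b ^ 2 : ℝ)
        ≤ 4 * (2 * 4 + 4) * cg + (4 * (4 + 2) * (3 * 4 + 8) + 14464 * (4 + 1) ^ 2 * (4 + 4) ^ 2) * 1 := by
      nlinarith [hb1]
    exact (relWidth_fineTest_ne3Layer (h16 K) (hN K) hθ hθ6 (hb K) (hbs K) (hg K) (hC K) (hΛ₂' K) hγ (hγ3 K) hl₁ (hΛl₁ K) hj1 hfit hV hA hB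
      hregB hcg hsup hε' ht z π r₀ hi₀ hj₀).trans
      (mul_le_mul_of_nonneg_right (div_le_div_of_nonneg_right (add_le_add (cQ_le_of_le hγ.le hl₁.le (hΛbar K)) hK) hε'.le)
        (pow_nonneg hθ.le j))
  exact exists_geometric_majorant hθ hrate

/-! ## §4 NE7c at explicit carriers with a geometric weight, from the layers + [dict] + node U2's threshold widths -/

/-- **NE7c's `ShellWeightBound` AT EXPLICIT CARRIERS FROM THE RATE HOME's NE3 LAYERS (road I, geometric weight).**  DATA: explicit term-class carriers
`(l₀, T, A, B, shA, shB)` of the two runs; their LEVEL LEDGERS ([dict] + (M1), widths `ρA`, `ρB`); LIVE WINDOWS (N20); `D ≤ D̄` (N12); THRESHOLD widths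
`τA, τB ≤ c₂ϑ₂^j`, `0 ≤ ϑ₂ < 1` (node U2: the relative band between the runs' coupling-dependent thresholds of record, `N21ThresholdSyncAtRecord` §3); §3's
inputs (`N16At` at every layer, uniform END letters, `θ`, `ε′`, `cg`); the two [dict] clauses «run A's (B's) level-`j` width ≤ (every uniform bound of §3's
variable relative widths) + `τA j` (`τB j`)».  CONCLUSION: `∃ C ≥ 0`, `ShellWeightBound l₀ T A B shA shB (K ↦ C·(θ ∨ ϑ₂)^K)` — §3 twice + dag-n21-a's knit at
the summed width (`n21_knit_levels_of_twoWidths`).  CONDITIONAL on every displayed binder; NE7c NOT proved; N21 NOT discharged. [folklore] -/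
theorem shellWeightBound_geometric_of_ne3Layers {cg : ℝ} (hcg : 0 ≤ cg)
    {ι σA σB : Type*} {l₀ : ℝ} {T : ℕ → Finset ι} {A B shA shB : ℕ → ℝ → ι → ℝ}
    {SA : ℕ → Finset σA} {SB : ℕ → Finset σB} {pieceA : ℕ → ℝ → σA → ι → ℝ} {pieceB : ℕ → ℝ → σB → ι → ℝ}
    {lvlA : ℕ → σA → ℕ} {lvlB : ℕ → σB → ℕ} {DA ρA DB ρB τA τB : ℕ → ℝ} {N₁ : ℕ} {νbar Dbar c₂ ϑ₂ : ℝ}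
    (hLA : LevelLedger l₀ T A shA SA pieceA lvlA DA ρA) (hLB : LevelLedger l₀ T B shB SB pieceB lvlB DB ρB)
    (hwA : LiveWindow SA lvlA N₁ νbar) (hwB : LiveWindow SB lvlB N₁ νbar) (hDA : ∀ j, DA j ≤ Dbar) (hDB : ∀ j, DB j ≤ Dbar)
    (hc₂ : 0 ≤ c₂) (h₂ : 0 ≤ ϑ₂) (h₂' : ϑ₂ < 1) (hτA : ∀ j, τA j ≤ c₂ * ϑ₂ ^ j) (hτB : ∀ j, τB j ≤ c₂ * ϑ₂ ^ j)
    (hdictA : ∀ j, 1 ≤ j → ∀ x : ℝ,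
      (∀ (K : ℕ) (V UA UB : B7Prop1Explicit.Site 4 → Fin 4 → (Matrix (Fin N) (Fin N) ℂ)ˣ) (z : B7Prop1Explicit.Site 4) (μ ν : Fin 4) (t : ℝ),
        V ∈ (o K).dom → IsMinimiser 4 (sfClass 4 F.L (o K).Nper (o K).ε) F.L (o K).Nper j V UA →
        IsMinimiser 4 (sfClass 4 F.L (o K).Nper (o K).ε) F.L (o K).Nper (j + 1) V UB → Regular 4 F.L (o K).Nper (o K).b (o K).g (j + 1) UB →
        ε' * ((F.L : ℝ)⁻¹) ^ (2 * j) ≤ t →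
        |‖((hol UA z (plaqWord μ ν) : (Matrix (Fin N) (Fin N) ℂ)ˣ) : Matrix (Fin N) (Fin N) ℂ) - 1‖
            - ‖((hol (rescale F.L (bavg F.L UB)) z (plaqWord μ ν) : (Matrix (Fin N) (Fin N) ℂ)ˣ) : Matrix (Fin N) (Fin N) ℂ) - 1‖| / t ≤ x) →
      ρA j ≤ x + τA j)
    (hdictB : ∀ j, 1 ≤ j → ∀ x : ℝ,
      (∀ (K : ℕ) (V UA UB : B7Prop1Explicit.Site 4 → Fin 4 → (Matrix (Fin N) (Fin N) ℂ)ˣ) (z : B7Prop1Explicit.Site 4) (π : Plane 4)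
        (r₀ : Fin 4 → Fin F.L) (i₀ j₀ : ℕ) (t : ℝ),
        V ∈ (o K).dom → IsMinimiser 4 (sfClass 4 F.L (o K).Nper (o K).ε) F.L (o K).Nper j V UA →
        IsMinimiser 4 (sfClass 4 F.L (o K).Nper (o K).ε) F.L (o K).Nper (j + 1) V UB → Regular 4 F.L (o K).Nper (o K).b (o K).g (j + 1) UB →
        RegularSup 4 F.L (o K).Nper (o K).b cg (j + 1) UB → i₀ < F.L → j₀ < F.L → ε' * ((F.L : ℝ)⁻¹) ^ (2 * j) ≤ t →
        |‖((hol UA z (plaqWord π.1.1 π.1.2) : (Matrix (Fin N) (Fin N) ℂ)ˣ) : Matrix (Fin N) (Fin N) ℂ) - 1‖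
            - (F.L : ℝ) ^ 2 * ‖((hol UB ((F.L : ℤ) • z + boxVec F.L r₀ + (i₀ : ℤ) • e π.1.1 + (j₀ : ℤ) • e π.1.2)
                (plaqWord π.1.1 π.1.2) : (Matrix (Fin N) (Fin N) ℂ)ˣ) : Matrix (Fin N) (Fin N) ℂ) - 1‖| / t ≤ x) →
      ρB j ≤ x + τB j) :
    ∃ C : ℝ, 0 ≤ C ∧ ShellWeightBound l₀ T A B shA shB fun K => C * max θ ϑ₂ ^ K := by
  obtain ⟨cA, hcA0, hcA⟩ := rate_of_slotWidths_ne3Layers h16 hθ hθ1 hθ6 hN hb hbs hg hC hΛ₂' hΛbar hγ hγ3 hl₁ hΛl₁ hε'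
    (ρ := fun j => ρA j - τA j) (fun j hj x hx => sub_le_iff_le_add.2 (hdictA j hj x hx))
  obtain ⟨cB, hcB0, hcB⟩ := rate_of_fineTestWidths_ne3Layers h16 hθ hθ1 hθ6 hN hb hbs hg hC hΛ₂' hΛbar hγ hγ3 hl₁ hΛl₁ hε' hcg
    (ρ := fun j => ρB j - τB j) (fun j hj x hx => sub_le_iff_le_add.2 (hdictB j hj x hx))
  have hrateA : ∀ j, ρA j ≤ max cA cB * θ ^ j + c₂ * ϑ₂ ^ j := fun j => by
    have h1 : ρA j - τA j ≤ cA * θ ^ j := hcA j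
    have h3 : cA * θ ^ j ≤ max cA cB * θ ^ j := mul_le_mul_of_nonneg_right (le_max_left _ _) (pow_nonneg hθ.le j)
    linarith [hτA j]
  have hrateB : ∀ j, ρB j ≤ max cA cB * θ ^ j + c₂ * ϑ₂ ^ j := fun j => by
    have h1 : ρB j - τB j ≤ cB * θ ^ j := hcB j
    have h3 : cB * θ ^ j ≤ max cA cB * θ ^ j := mul_le_mul_of_nonneg_right (le_max_right _ _) (pow_nonneg hθ.le j)
    linarith [hτB j]
  have hν : 0 ≤ νbar := hwA.νbar_nonneg
  have hDbar : 0 ≤ Dbar := (hLA.D_nonneg 0).trans (hDA 0)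
  have hmax0 : 0 < max θ ϑ₂ := lt_max_of_lt_left hθ
  refine ⟨2 * ((N₁ + 1) * νbar * Dbar * (max cA cB + c₂) * (max θ ϑ₂)⁻¹ ^ N₁), ?_, ?_⟩
  · have h1 : 0 ≤ max cA cB + c₂ := add_nonneg (le_max_of_le_left hcA0) hc₂
    exact mul_nonneg zero_le_two (mul_nonneg (mul_nonneg (mul_nonneg (mul_nonneg (by positivity) hν) hDbar) h1)
      (pow_nonneg (inv_nonneg.2 hmax0.le) N₁))
  · exact n21_knit_levels_of_twoWidths (le_max_of_le_left hcA0) hc₂ hθ hθ1 h₂ h₂' hLA hLB hwA hwB hDA hDB hrateA hrateB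
      (fun K => le_rfl) ((summable_geometric_of_lt_one hmax0.le (max_lt hθ1 h₂')).mul_left _)

end Rate

/-- **`S_N21 SRec` ON ROAD I AT THE SUM OF TWO WIDTH FAMILIES, ANY SPINE-CARRIER PREDICATE** (generic; one application at any keyed spine home `SRec₁₂ cr`, …):
if every bundle `S` the predicate pins somewhere carries the two runs' LEVEL LEDGERS, LIVE WINDOWS, `D ≤ D̄`, level widths dominated by `c₁ϑ₁^j + c₂ϑ₂^j` (the
VARIABLE width of §3 at the family base + the THRESHOLD width of node U2) with `0 ≤ c₁, c₂`, `0 < ϑ₁ < 1`, `0 ≤ ϑ₂ < 1`, and a summable weight slot `S.Wsh`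
dominating `2((N₁+1)ν̄D̄(c₁+c₂)(ϑ₁∨ϑ₂)^{−N₁})(ϑ₁∨ϑ₂)^K`, then `S_N21 SRec` — `n21_knit_levels_of_twoWidths` per pinned bundle (the two-width twin of n21-a's
`N21AtSpineCarriers.s_N21_of_levelsReading`).  CONDITIONAL on every displayed binder; NE7c NOT proved. [folklore] -/
theorem s_N21_of_levels_twoWidths (SRec : SpineRecordPred N)
    (hread : ∀ (F : T4Family) (D : Datum F N) (g₀ : ℕ → ℝ) (os : List (ULoop F)) (S : SpineCarriers), SRec F D g₀ os S →
      ∃ (σA σB : Type) (SA : ℕ → Finset σA) (SB : ℕ → Finset σB) (pieceA : ℕ → ℝ → σA → S.ι → ℝ)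
        (pieceB : ℕ → ℝ → σB → S.ι → ℝ) (lvlA : ℕ → σA → ℕ) (lvlB : ℕ → σB → ℕ) (DA ρA DB ρB : ℕ → ℝ)
        (N₁ : ℕ) (νbar Dbar c₁ c₂ ϑ₁ ϑ₂ : ℝ),
        LevelLedger S.l₀ S.T S.A S.shA SA pieceA lvlA DA ρA ∧ LevelLedger S.l₀ S.T S.B S.shB SB pieceB lvlB DB ρB ∧
        LiveWindow SA lvlA N₁ νbar ∧ LiveWindow SB lvlB N₁ νbar ∧ (∀ j, DA j ≤ Dbar) ∧ (∀ j, DB j ≤ Dbar) ∧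
        0 ≤ c₁ ∧ 0 ≤ c₂ ∧ 0 < ϑ₁ ∧ ϑ₁ < 1 ∧ 0 ≤ ϑ₂ ∧ ϑ₂ < 1 ∧
        (∀ j, ρA j ≤ c₁ * ϑ₁ ^ j + c₂ * ϑ₂ ^ j) ∧ (∀ j, ρB j ≤ c₁ * ϑ₁ ^ j + c₂ * ϑ₂ ^ j) ∧
        (∀ K, (2 * ((N₁ + 1) * νbar * Dbar * (c₁ + c₂) * (max ϑ₁ ϑ₂)⁻¹ ^ N₁)) * max ϑ₁ ϑ₂ ^ K ≤ S.Wsh K) ∧ Summable S.Wsh) :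
    S_N21 SRec := by
  intro F D g₀ os S hS
  obtain ⟨σA, σB, SA, SB, pieceA, pieceB, lvlA, lvlB, DA, ρA, DB, ρB, N₁, νbar, Dbar, c₁, c₂, ϑ₁, ϑ₂, hA, hB, hwA, hwB, hDA, hDB,
    hc₁, hc₂, h₁, h₁', h₂, h₂', hrateA, hrateB, hWsh, hsum⟩ := hread F D g₀ os S hS
  exact n21_knit_levels_of_twoWidths hc₁ hc₂ h₁ h₁' h₂ h₂' hA hB hwA hwB hDA hDB hrateA hrateB hWsh hsum

/-! ## §5 At ANY keyed rate home BY NAME: the in-edge as the K4 stub `S_N16 RRec` for a home attaining the reading's literals -/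

section KeyedHome

variable {key : (F : T4Family) → Datum F N → Prop}
  (ne3At : ∀ {F : T4Family} {D : Datum F N}, key F D → (ℕ → ℝ) → List (ULoop F) → ℕ → NE3Objects₁₁ N)
  (RRec : RateRecordPred N)

/-- **NE7c AT EXPLICIT CARRIERS FROM THE K4 STUB `S_N16 RRec` AT ANY KEYED HOME.**  For a key `key`, a key-indexed NE3 reading `ne3At`, a home `RRec` that ATTAINS
the reading's literals (`hatt`; Stage 11: `N16AtKeyedHome.attains_rRec₁₁` — empty key, `Node00.not_provisos₁₁`; Stage 12 likewise), the stub `hS : S_N16 RRec` BY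
NAME, a key proof `h` and `(g₀, os)`: `shellWeightBound_geometric_of_ne3Layers` at the layers `K ↦ ne3At h g₀ os K`, the in-edge delivered by
`covRoot_of_attains`; every other binder displayed as there.  CONDITIONAL; NE7c NOT proved; N21 NOT discharged. [folklore] -/
theorem shellWeightBound_geometric_of_attains
    (hatt : ∀ (F : T4Family) (D : Datum F N) (h : key F D) (g₀ : ℕ → ℝ) (os : List (ULoop F)) (k : ℕ),
      ∃ R : RateCarriers N, RRec F D g₀ os R ∧ R.ne3 = ne3OfRecord₁₁ F (ne3At h g₀ os k))
    (hS : S_N16 RRec) {F : T4Family} {D : Datum F N} (h : key F D) (g₀ : ℕ → ℝ) (os : List (ULoop F))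
    {θ γ l₁ Λbar ε' cg : ℝ} (hθ : 0 < θ) (hθ1 : θ < 1) (hθ6 : θ ^ 6 = ((F.L : ℝ))⁻¹)
    (hN : ∀ K, 1 ≤ (ne3At h g₀ os K).Nper) (hb : ∀ K, 0 ≤ (ne3At h g₀ os K).b)
    (hbs : ∀ K, 512 * (4 + 1) * (4 + 4) * (F.L : ℝ) ^ 2 * (ne3At h g₀ os K).b ≤ 1)
    (hg : ∀ K, 0 ≤ (ne3At h g₀ os K).g) (hC : ∀ K, 0 ≤ (ne3At h g₀ os K).C) (hΛ₂' : ∀ K, 0 < (ne3At h g₀ os K).Λ₂')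
    (hΛbar : ∀ K, (ne3At h g₀ os K).Λ₂' ≤ Λbar) (hγ : 0 < γ)
    (hγ3 : ∀ K, (ne3At h g₀ os K).C * (wallConst 4 F.L * ((ne3At h g₀ os K).Nper : ℝ) ^ 2 *
      (Real.sqrt (ne3At h g₀ os K).g * dualC2 4 F.L + 2 * (ne3At h g₀ os K).b ^ 2 * dualC1 4 F.L)) ≤ γ ^ 3)
    (hl₁ : 0 < l₁) (hΛl₁ : ∀ K, (ne3At h g₀ os K).Λ₁ ≤ l₁ ^ 3) (hε' : 0 < ε') (hcg : 0 ≤ cg)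
    {ι σA σB : Type*} {l₀ : ℝ} {T : ℕ → Finset ι} {A B shA shB : ℕ → ℝ → ι → ℝ}
    {SA : ℕ → Finset σA} {SB : ℕ → Finset σB} {pieceA : ℕ → ℝ → σA → ι → ℝ} {pieceB : ℕ → ℝ → σB → ι → ℝ}
    {lvlA : ℕ → σA → ℕ} {lvlB : ℕ → σB → ℕ} {DA ρA DB ρB τA τB : ℕ → ℝ} {N₁ : ℕ} {νbar Dbar c₂ ϑ₂ : ℝ}
    (hLA : LevelLedger l₀ T A shA SA pieceA lvlA DA ρA) (hLB : LevelLedger l₀ T B shB SB pieceB lvlB DB ρB)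
    (hwA : LiveWindow SA lvlA N₁ νbar) (hwB : LiveWindow SB lvlB N₁ νbar) (hDA : ∀ j, DA j ≤ Dbar) (hDB : ∀ j, DB j ≤ Dbar)
    (hc₂ : 0 ≤ c₂) (h₂ : 0 ≤ ϑ₂) (h₂' : ϑ₂ < 1) (hτA : ∀ j, τA j ≤ c₂ * ϑ₂ ^ j) (hτB : ∀ j, τB j ≤ c₂ * ϑ₂ ^ j)
    (hdictA : ∀ j, 1 ≤ j → ∀ x : ℝ,
      (∀ (K : ℕ) (V UA UB : B7Prop1Explicit.Site 4 → Fin 4 → (Matrix (Fin N) (Fin N) ℂ)ˣ) (z : B7Prop1Explicit.Site 4) (μ ν : Fin 4) (t : ℝ),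
        V ∈ (ne3At h g₀ os K).dom →
        IsMinimiser 4 (sfClass 4 F.L (ne3At h g₀ os K).Nper (ne3At h g₀ os K).ε) F.L (ne3At h g₀ os K).Nper j V UA →
        IsMinimiser 4 (sfClass 4 F.L (ne3At h g₀ os K).Nper (ne3At h g₀ os K).ε) F.L (ne3At h g₀ os K).Nper (j + 1) V UB →
        Regular 4 F.L (ne3At h g₀ os K).Nper (ne3At h g₀ os K).b (ne3At h g₀ os K).g (j + 1) UB → ε' * ((F.L : ℝ)⁻¹) ^ (2 * j) ≤ t →
        |‖((hol UA z (plaqWord μ ν) : (Matrix (Fin N) (Fin N) ℂ)ˣ) : Matrix (Fin N) (Fin N) ℂ) - 1‖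
            - ‖((hol (rescale F.L (bavg F.L UB)) z (plaqWord μ ν) : (Matrix (Fin N) (Fin N) ℂ)ˣ) : Matrix (Fin N) (Fin N) ℂ) - 1‖| / t ≤ x) →
      ρA j ≤ x + τA j)
    (hdictB : ∀ j, 1 ≤ j → ∀ x : ℝ,
      (∀ (K : ℕ) (V UA UB : B7Prop1Explicit.Site 4 → Fin 4 → (Matrix (Fin N) (Fin N) ℂ)ˣ) (z : B7Prop1Explicit.Site 4) (π : Plane 4)
        (r₀ : Fin 4 → Fin F.L) (i₀ j₀ : ℕ) (t : ℝ),
        V ∈ (ne3At h g₀ os K).dom →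
        IsMinimiser 4 (sfClass 4 F.L (ne3At h g₀ os K).Nper (ne3At h g₀ os K).ε) F.L (ne3At h g₀ os K).Nper j V UA →
        IsMinimiser 4 (sfClass 4 F.L (ne3At h g₀ os K).Nper (ne3At h g₀ os K).ε) F.L (ne3At h g₀ os K).Nper (j + 1) V UB →
        Regular 4 F.L (ne3At h g₀ os K).Nper (ne3At h g₀ os K).b (ne3At h g₀ os K).g (j + 1) UB →
        RegularSup 4 F.L (ne3At h g₀ os K).Nper (ne3At h g₀ os K).b cg (j + 1) UB → i₀ < F.L → j₀ < F.L →
        ε' * ((F.L : ℝ)⁻¹) ^ (2 * j) ≤ t →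
        |‖((hol UA z (plaqWord π.1.1 π.1.2) : (Matrix (Fin N) (Fin N) ℂ)ˣ) : Matrix (Fin N) (Fin N) ℂ) - 1‖
            - (F.L : ℝ) ^ 2 * ‖((hol UB ((F.L : ℤ) • z + boxVec F.L r₀ + (i₀ : ℤ) • e π.1.1 + (j₀ : ℤ) • e π.1.2)
                (plaqWord π.1.1 π.1.2) : (Matrix (Fin N) (Fin N) ℂ)ˣ) : Matrix (Fin N) (Fin N) ℂ) - 1‖| / t ≤ x) →
      ρB j ≤ x + τB j) :
    ∃ C : ℝ, 0 ≤ C ∧ ShellWeightBound l₀ T A B shA shB fun K => C * max θ ϑ₂ ^ K :=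
  shellWeightBound_geometric_of_ne3Layers (o := fun K => ne3At h g₀ os K)
    (fun K => (n16At_ne3OfRecord₁₁_iff F _).2 (covRoot_of_attains ne3At RRec hatt hS F D h g₀ os K))
    hθ hθ1 hθ6 hN hb hbs hg hC hΛ₂' hΛbar hγ hγ3 hl₁ hΛl₁ hε' hcg hLA hLB hwA hwB hDA hDB hc₂ h₂ h₂' hτA hτB hdictA hdictB

end KeyedHome

end Summit.QuantumFields.YangMills.Theorems.N21AtKeyedRateHome

end
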